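import Summits.CriticalPhenomena.PercolationContinuityZ3.Theorems.PercNearOneGluingNoHeavyQuantGatedSliceMixLawQRoutingLow
import Summits.CriticalPhenomena.PercolationContinuityZ3.Theorems.PercNearOneGluingNoHeavyQuantGatedSliceMixLawQKIneq
import Summits.CriticalPhenomena.PercolationContinuityZ3.Theorems.PercNearOneGluingNoHeavyQuantLawDecUsageMonge
import Summits.CriticalPhenomena.PercolationContinuityZ3.Theorems.PercNearOneGluingNoHeavyQuantFlowPieces
import HarnessLib

/-!
# QUANT lane R8, T-DEC, leg (III), blob case — `LawDec.GatedSliceMixLaw'`, Q-ALONE side: cell QK (the top `k₂` a `t`-low), part B —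
# the twin ABOVE `t`, `k₁ ≥ 1`, the top fits: the low `k₁` saturates the rest of the twin (class `LM`)

builds on p205010 (kernel theorem, internal audit signed; external expert review pending)

Support file (`--supports stmt-CriticalPhenomena-4575`), QUANT lane seat prim-quant-arm-1 (gen 41), rung R8 of `run/shared/lean/prim/quant/LADDER.md`.
Theorems only, standard axioms, no sorries, no definitions.  Uses `…QRoutingLow` and the scalar lemmas of `…QKIneq`.  Setting (cell QK, class
`LM`): frame of the node; `1 ≤ k₁ ≤ j`, `2k₁ < t`, twin `P = k₁ + a ≤ j` with `t < P`, top `K = k₂ ≤ j` with `2K < t`, `G = k₂ + a ≥ j+1`, and the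
top fits in the twin (`usage(K,P)·C ≤ B`).  ROUTING: all of `K` into `P`; if `k₁` fits in the rest (`usage(k₁,P)A + usage(K,P)C ≤ B`) nothing
else is needed (`…_of_lowsAbsorb`); otherwise `k₁` saturates the rest (`x₁ = (B − usage(K,P)C)/usage(k₁,P)`), its overflow and the zero ride
the giant, which suffices iff  (Ib)  `usage(k₁,P)·(y(z+A) − (1−y)D) ≤ y·(B − usage(K,P)·C)`.
* **`mixLawQ_decAtT_qk_twinHigh_of_Ib`** — the routing, from (Ib).
* **`mixLawQ_decAtT_qk_twinHigh_heavyTop`** — (Ib) when the top is HEAVY at the twin (`y·(P−K) ≤ t − 2K`): `usage(k₁,P) ≤ (t−k₁)/(P−t)`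
  (`usage_mid_mul_le`) and `qk_Ib_heavyTop` (the Positivstellensatz certificate `qk_T4`, affine in `y`).
* **`mixLawQ_decAtT_qk_twinHigh_lightBoth`** — (Ib) when BOTH pairs are light (`t − 2K < y(P−K)`, `t − 2k₁ < y·a`): both usages are
  `≤ y/(1−y)` and (Ib) is the threshold `y ≤ (1−z)g` (`qk_Ib_ll`).
The remaining sub-case (top light, `k₁` heavy) and the assembly of cell QK are part C.  EXACT CENSUS (`work/explore/qQK*.py`): 25 579 / 0.
HONEST STATUS: `GatedSliceMixLaw'` (regime R), CW, `GateMove`, `GatedConvEmptyFree`, `SingleGateConvClosed`, `TreeDEC`, `FarTreeRow` OPEN; RATE unchanged.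

[this work]; node: prim-quant-stmt g29/g30 (this lane).  Nothing here is cited as a published result.  The gluing rows served
[cite: KozmaNitzan2024, Conjecture 3 (p. 15)]; product measure [cite: Grimmett1999, §1.3 p. 10].
-/

noncomputable section

namespace Summit.CriticalPhenomena.PercolationContinuityZ3.Theorems

namespace Quant

open Finset

/-- the two-point law `{lo, hi; g}` (as in `…QuantLawDEC`) -/
local notation3 "TP[" lo ", " hi ", " g ", " h "]" =>
  (g : ℝ) * (if (h : ℕ) = (hi : ℕ) then (1 : ℝ) else 0) + (1 - (g : ℝ)) * (if (h : ℕ) = (lo : ℕ) then (1 : ℝ) else 0)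

namespace LawDec

set_option maxHeartbeats 800000 in
/-- **CELL QK, CLASS `LM`, FROM (Ib).**  See the file header. [this work] -/
theorem mixLawQ_decAtT_qk_twinHigh_of_Ib (y z g S lam : ℝ) (a j M k₁ k₂ : ℕ)
    (hy0 : 0 < y) (hy1 : y < 1) (hz0 : 0 ≤ z) (hz1 : z < 1) (hg1 : g ≤ 1) (hyg : y ≤ (1 - z) * g) (ha : 1 ≤ a)
    (hta : y * (M : ℝ) ≤ S) (hk : k₁ ≤ k₂) (hk₂M : k₂ ≤ M) (hlam0 : 0 ≤ lam) (hlam1 : lam ≤ 1)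
    (hmean : (1 - z) * ((k₁ : ℝ) + ((k₂ : ℝ) - k₁) * lam) = S)
    (hk₁ : 1 ≤ k₁) (hk₁j : k₁ ≤ j) (hk₁low : 2 * (k₁ : ℝ) < S + (a : ℝ) * g * (1 - z))
    (hPj : k₁ + a ≤ j) (hPmid : S + (a : ℝ) * g * (1 - z) ≤ 2 * ((k₁ + a : ℕ) : ℝ)) (hPt : S + (a : ℝ) * g * (1 - z) < (k₁ : ℝ) + a)
    (hKj : k₂ ≤ j) (hKlow : 2 * (k₂ : ℝ) < S + (a : ℝ) * g * (1 - z)) (hG : j + 1 ≤ k₂ + a)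
    (hfit : usage y (S + (a : ℝ) * g * (1 - z)) j k₂ (k₁ + a) * ((1 - z) * lam * (1 - g)) ≤ (1 - z) * (1 - lam) * g)
    (hIb : usage y (S + (a : ℝ) * g * (1 - z)) j k₁ (k₁ + a) * (y * (z + (1 - z) * (1 - lam) * (1 - g)) - (1 - y) * ((1 - z) * lam * g))
      ≤ y * ((1 - z) * (1 - lam) * g - usage y (S + (a : ℝ) * g * (1 - z)) j k₂ (k₁ + a) * ((1 - z) * lam * (1 - g)))) :
    DECAtT y (S + (a : ℝ) * g * (1 - z)) j (M + a)
      (fun p => z * (if p = 0 then (1 : ℝ) else 0) + (1 - z) * slice (fun q => TP[k₁, k₂, lam, q]) a g p) := by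
  set t : ℝ := S + (a : ℝ) * g * (1 - z) with ht
  set A : ℝ := (1 - z) * (1 - lam) * (1 - g) with hA
  set B : ℝ := (1 - z) * (1 - lam) * g with hB
  set C : ℝ := (1 - z) * lam * (1 - g) with hC
  set D : ℝ := (1 - z) * lam * g with hD
  set U₁ : ℝ := usage y t j k₁ (k₁ + a) with hU₁
  set U₂ : ℝ := usage y t j k₂ (k₁ + a) with hU₂
  have hg0 : 0 < g := by
    by_contra hc
    have : (1 - z) * g ≤ 0 := mul_nonpos_of_nonneg_of_nonpos (by linarith) (not_lt.1 hc)
    linarith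
  have h1z : 0 < 1 - z := by linarith
  have h1y : 0 < 1 - y := by linarith
  have hA0 : 0 ≤ A := mul_nonneg (mul_nonneg h1z.le (by linarith)) (by linarith)
  have hC0 : 0 ≤ C := mul_nonneg (mul_nonneg h1z.le hlam0) (by linarith)
  have hD0 : 0 ≤ D := mul_nonneg (mul_nonneg h1z.le hlam0) hg0.le
  have ht0 : 0 < t := by have : (0:ℝ) ≤ k₁ := Nat.cast_nonneg k₁; linarith
  have hPr : ((k₁ + a : ℕ) : ℝ) = (k₁ : ℝ) + a := by push_cast; ring
  have hPng : ¬ (j + 1 ≤ k₁ + a) := by omega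
  have hPcomp : t < (k₁ : ℝ) + ((k₁ + a : ℕ) : ℝ) := by
    have : (0:ℝ) ≤ k₁ := Nat.cast_nonneg k₁
    rw [hPr]; linarith
  have huG₁ : usage y t j k₁ (k₂ + a) = y / (1 - y) := usage_giant_eq y t j k₁ (k₂ + a) hG
  -- `U₁ ≥ 0`
  have hU₁0 : 0 ≤ U₁ := by
    have hγ0 : 0 < pairGate y t k₁ (k₁ + a) := pairGate_pos y t k₁ (k₁ + a) hk₁low (by omega)
    have hγ1 : pairGate y t k₁ (k₁ + a) < 1 := pairGate_lt_one y t k₁ (k₁ + a) hy0 hy1 hk₁low hPcomp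
    rw [hU₁]; simp only [usage, gateOf, if_neg hPng]
    exact div_nonneg hγ0.le (by linarith)
  by_cases hall : U₁ * A + U₂ * C ≤ B
  · -- both lows fit in the twin
    refine mixLawQ_decAtT_of_lowsAbsorb y z g S lam a j M k₁ k₂ hy0 hy1 hz0 hz1 hg1 hyg ha hta hk hk₂M hlam0 hlam1 hmean hk₁j hk₁low
      hPj hPmid hKj hKlow hG (fun _ => hPcomp) ?_
    rw [if_pos hk₁, mul_one]; exact hall
  · -- `k₁` saturates the rest of the twin
    have hall' : B < U₁ * A + U₂ * C := not_le.1 hall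
    have hU₁pos : 0 < U₁ := by
      rcases lt_or_eq_of_le hU₁0 with h | h
      · exact h
      · exfalso; rw [← h, zero_mul, zero_add] at hall'; exact absurd hfit (not_le.2 hall')
    set x₁ : ℝ := (B - U₂ * C) / U₁ with hx₁
    have hx₁0 : 0 ≤ x₁ := div_nonneg (by linarith) hU₁pos.le
    have hU₁x₁ : U₁ * x₁ = B - U₂ * C := by rw [hx₁]; field_simp
    have hx₁A : x₁ < A := by
      by_contra hc
      have : U₁ * A ≤ U₁ * x₁ := mul_le_mul_of_nonneg_left (not_lt.1 hc) hU₁pos.le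
      rw [hU₁x₁] at this; linarith
    -- from (Ib): `y(z + A) − (1−y)D ≤ y·x₁`
    have hE : y * (z + A) - (1 - y) * D ≤ y * x₁ := by
      have h1 : U₁ * (y * (z + A) - (1 - y) * D) ≤ U₁ * (y * x₁) := by
        have e : U₁ * (y * x₁) = y * (B - U₂ * C) := by rw [← hU₁x₁]; ring
        rw [e]; exact hIb
      exact le_of_mul_le_mul_left h1 hU₁pos
    have hcapG : usage y t j k₁ (k₂ + a) * (A - x₁) + usage y t j k₂ (k₂ + a) * 0 ≤ D := by
      rw [mul_zero, add_zero, huG₁, div_mul_eq_mul_div, div_le_iff₀ h1y]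
      nlinarith [mul_nonneg hy0.le hz0]
    refine mixLawQ_decAtT_of_routing_low y z g S lam a j M k₁ k₂ x₁ (A - x₁) C 0 hy0 hy1 hz0 hz1 hg1 hyg ha hta hk hk₂M hlam0 hlam1
      hmean hk₁j hk₁low hPj hPmid hKj hKlow hG hx₁0 (by linarith) hC0 le_rfl (fun _ => by ring) (fun h0 => absurd h0 (by omega))
      (by ring) (fun _ => hPcomp) (by rw [hU₁x₁]; linarith) hcapG ?_
    -- the offer: the twin is exactly full, the giant's leftover `D − u(A − x₁)` absorbs the zero
    rw [hU₁x₁, mul_zero, add_zero, huG₁]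
    have hfull : B - (B - U₂ * C + U₂ * C) = 0 := by ring
    rw [hfull, mul_zero, zero_add]
    have hz' : z + (A - x₁ - (A - x₁)) = z := by ring
    rw [hz']
    have e : t * (1 - y) / y * (D - y / (1 - y) * (A - x₁)) = t * ((1 - y) / y * D - (A - x₁)) := by
      have hy0' : y ≠ 0 := ne_of_gt hy0
      have h1y' : 1 - y ≠ 0 := ne_of_gt h1y
      field_simp
    rw [e]
    refine mul_le_mul_of_nonneg_left ?_ ht0.le
    rw [div_mul_eq_mul_div, le_sub_iff_add_le, le_div_iff₀ hy0]
    nlinarith [hE]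

set_option maxHeartbeats 800000 in
/-- **CELL QK, CLASS `LM`, THE TOP HEAVY AT THE TWIN ⟹ `Q` IS DEC.**  See the file header. [this work] -/
theorem mixLawQ_decAtT_qk_twinHigh_heavyTop (y z g S lam : ℝ) (a j M k₁ k₂ : ℕ)
    (hy0 : 0 < y) (hy1 : y < 1) (hz0 : 0 ≤ z) (hz1 : z < 1) (hg1 : g ≤ 1) (hyg : y ≤ (1 - z) * g) (ha : 1 ≤ a)
    (hta : y * (M : ℝ) ≤ S) (hk : k₁ ≤ k₂) (hk₂M : k₂ ≤ M) (hlam0 : 0 ≤ lam) (hlam1 : lam ≤ 1)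
    (hmean : (1 - z) * ((k₁ : ℝ) + ((k₂ : ℝ) - k₁) * lam) = S)
    (hk₁ : 1 ≤ k₁) (hk₁j : k₁ ≤ j) (hk₁low : 2 * (k₁ : ℝ) < S + (a : ℝ) * g * (1 - z))
    (hPj : k₁ + a ≤ j) (hPmid : S + (a : ℝ) * g * (1 - z) ≤ 2 * ((k₁ + a : ℕ) : ℝ)) (hPt : S + (a : ℝ) * g * (1 - z) < (k₁ : ℝ) + a)
    (hKj : k₂ ≤ j) (hKlow : 2 * (k₂ : ℝ) < S + (a : ℝ) * g * (1 - z)) (hG : j + 1 ≤ k₂ + a)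
    (hfit : usage y (S + (a : ℝ) * g * (1 - z)) j k₂ (k₁ + a) * ((1 - z) * lam * (1 - g)) ≤ (1 - z) * (1 - lam) * g)
    (hheavy : y * (((k₁ : ℝ) + a) - k₂) ≤ S + (a : ℝ) * g * (1 - z) - 2 * (k₂ : ℝ)) :
    DECAtT y (S + (a : ℝ) * g * (1 - z)) j (M + a)
      (fun p => z * (if p = 0 then (1 : ℝ) else 0) + (1 - z) * slice (fun q => TP[k₁, k₂, lam, q]) a g p) := by
  set t : ℝ := S + (a : ℝ) * g * (1 - z) with ht
  set A : ℝ := (1 - z) * (1 - lam) * (1 - g) with hA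
  set B : ℝ := (1 - z) * (1 - lam) * g with hB
  set C : ℝ := (1 - z) * lam * (1 - g) with hC
  set D : ℝ := (1 - z) * lam * g with hD
  have hg0 : 0 < g := by
    by_contra hc
    have : (1 - z) * g ≤ 0 := mul_nonpos_of_nonneg_of_nonpos (by linarith) (not_lt.1 hc)
    linarith
  have h1z : 0 < 1 - z := by linarith
  have h1y : 0 < 1 - y := by linarith
  have hC0 : 0 ≤ C := mul_nonneg (mul_nonneg h1z.le hlam0) (by linarith)
  have hkr : (k₁ : ℝ) ≤ k₂ := by exact_mod_cast hk
  have hk₁0 : (0 : ℝ) ≤ k₁ := Nat.cast_nonneg k₁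
  have hPr : ((k₁ + a : ℕ) : ℝ) = (k₁ : ℝ) + a := by push_cast; ring
  have hPng : ¬ (j + 1 ≤ k₁ + a) := by omega
  have hPcomp : t < (k₁ : ℝ) + ((k₁ + a : ℕ) : ℝ) := by rw [hPr]; linarith
  -- the pair (K, P), heavy: `usage = W₂/(p + K)`
  set W₂ : ℝ := t - 2 * (k₂ : ℝ) with hW₂
  set d₂ : ℝ := ((k₁ + a : ℕ) : ℝ) - (k₂ : ℝ) with hd₂
  set p : ℝ := ((k₁ + a : ℕ) : ℝ) - t with hp
  have hW₂0 : 0 < W₂ := by rw [hW₂]; linarith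
  have hp0 : 0 < p := by rw [hp, hPr]; linarith
  have hd₂0 : 0 < d₂ := by rw [hd₂]; linarith
  have hpK : 0 < p + (k₂ : ℝ) := by have : (0:ℝ) ≤ k₂ := Nat.cast_nonneg k₂; linarith
  have hdW : d₂ - W₂ = p + k₂ := by rw [hd₂, hW₂, hp]; ring
  set ρ₂ : ℝ := W₂ / d₂ with hρ₂
  have hρ0 : 0 < ρ₂ := div_pos hW₂0 hd₂0
  have hρ1 : ρ₂ < 1 := by rw [hρ₂, div_lt_one hd₂0]; linarith
  have hyρ : y ≤ ρ₂ := by rw [hρ₂, le_div_iff₀ hd₂0, hd₂, hPr]; exact hheavy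
  have huK : usage y t j k₂ (k₁ + a) = ρ₂ / (1 - ρ₂) := by
    have hmax : y ^ 2 + (1 - y) * ρ₂ ≤ ρ₂ := by
      have h := mul_nonpos_of_nonneg_of_nonpos hy0.le (sub_nonpos.2 hyρ)
      have e : y ^ 2 + (1 - y) * ρ₂ = ρ₂ + y * (y - ρ₂) := by ring
      rw [e]; linarith
    simp only [usage, gateOf, if_neg hPng, pairGate]
    rw [← hW₂, ← hd₂, ← hρ₂, max_eq_left hmax]
  have hU₂W : usage y t j k₂ (k₁ + a) * (p + k₂) = W₂ := by
    rw [huK, ← hdW, hρ₂]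
    have hdne : d₂ ≠ 0 := ne_of_gt hd₂0
    have hdWne : d₂ - W₂ ≠ 0 := by rw [hdW]; exact ne_of_gt hpK
    field_simp
  -- top-affordability of `P`, and `usage(k₁,P)·p ≤ t − k₁`
  have hyK : y * (k₂ : ℝ) ≤ S := (mul_le_mul_of_nonneg_left (by exact_mod_cast hk₂M) hy0.le).trans hta
  have hya : y * (a : ℝ) ≤ (a : ℝ) * g * (1 - z) := by
    have := mul_le_mul_of_nonneg_right hyg (Nat.cast_nonneg a)
    linarith [show (1 - z) * g * (a : ℝ) = (a : ℝ) * g * (1 - z) by ring]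
  have hyP : y * (((k₁ + a : ℕ) : ℝ)) ≤ t := by
    rw [hPr, mul_add, ht]
    have : y * (k₁ : ℝ) ≤ y * k₂ := mul_le_mul_of_nonneg_left hkr hy0.le
    linarith
  have hU₁p : usage y t j k₁ (k₁ + a) * p ≤ t - k₁ := by
    rw [hp]; exact usage_mid_mul_le y t j k₁ (k₁ + a) hy0 hy1 hk₁low hPj hPcomp hyP
  have hU₁0 : 0 ≤ usage y t j k₁ (k₁ + a) := by
    have hγ0 : 0 < pairGate y t k₁ (k₁ + a) := pairGate_pos y t k₁ (k₁ + a) hk₁low (by omega)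
    have hγ1 : pairGate y t k₁ (k₁ + a) < 1 := pairGate_lt_one y t k₁ (k₁ + a) hy0 hy1 hk₁low hPcomp
    simp only [usage, gateOf, if_neg hPng]
    exact div_nonneg hγ0.le (by linarith)
  refine mixLawQ_decAtT_qk_twinHigh_of_Ib y z g S lam a j M k₁ k₂ hy0 hy1 hz0 hz1 hg1 hyg ha hta hk hk₂M hlam0 hlam1 hmean hk₁ hk₁j
    hk₁low hPj hPmid hPt hKj hKlow hG hfit ?_
  -- (Ib): trivial when `X = y(z+A) − (1−y)D ≤ 0`; else `usage(k₁,P) ≤ (t−k₁)/p` and `qk_Ib_heavyTop`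
  set X : ℝ := y * (z + A) - (1 - y) * D with hX
  have hfit' : 0 ≤ B - usage y t j k₂ (k₁ + a) * C := by linarith
  by_cases hXle : X ≤ 0
  · have h1 : usage y t j k₁ (k₁ + a) * X ≤ 0 := mul_nonpos_of_nonneg_of_nonpos hU₁0 hXle
    nlinarith [mul_nonneg hy0.le hfit']
  · have hXpos : 0 < X := not_le.1 hXle
    have hT := qk_Ib_heavyTop y z g lam S (k₁ : ℝ) (k₂ : ℝ) (a : ℝ) hy0.le hz0 hz1.le hg0.le hg1 hlam0 hk₁0 hkr hmean
      (by rw [← hW₂]; exact hW₂0) (by rw [← ht]; have := hpK; rw [hp, hPr] at this; linarith)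
      (by rw [← ht]; exact hheavy)
    -- `hT : (t − k₁)·(yE − D)·(p+K) ≤ y·p·(B(p+K) − W₂C)` with `yE − D = X`
    have hEX : y * (1 - (1 - z) * (1 - lam) * g - (1 - z) * lam * (1 - g)) - (1 - z) * lam * g = X := by
      rw [hX, hA, hD]; ring
    have hp' : (k₁ : ℝ) + a - (S + (a : ℝ) * g * (1 - z)) = p := by rw [hp, hPr]
    have hq' : (k₁ : ℝ) + a - (S + (a : ℝ) * g * (1 - z)) + k₂ = p + k₂ := by rw [hp, hPr]
    rw [hEX, hq', hp', ← ht, ← hW₂] at hT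
    -- `hT : (t − k₁)·X·(p+K) ≤ y·p·(B(p+K) − W₂C)`; and `W₂ = U₂(p+K)`
    have h2 : usage y t j k₁ (k₁ + a) * X * (p * (p + k₂)) ≤ (t - k₁) * X * (p + k₂) := by
      have := mul_le_mul_of_nonneg_right hU₁p (mul_nonneg hXpos.le hpK.le)
      have e1 : usage y t j k₁ (k₁ + a) * X * (p * (p + k₂)) = usage y t j k₁ (k₁ + a) * p * (X * (p + k₂)) := by ring
      have e2 : (t - k₁) * X * (p + k₂) = (t - k₁) * (X * (p + k₂)) := by ring
      rw [e1, e2]; exact this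
    have h3 : y * p * (B * (p + k₂) - W₂ * C) = y * (B - usage y t j k₂ (k₁ + a) * C) * (p * (p + k₂)) := by
      rw [← hU₂W]; ring
    have h4 : usage y t j k₁ (k₁ + a) * X * (p * (p + k₂)) ≤ y * (B - usage y t j k₂ (k₁ + a) * C) * (p * (p + k₂)) := by
      rw [← h3]; exact h2.trans (by rw [hB, hC]; exact hT)
    exact le_of_mul_le_mul_right h4 (mul_pos hp0 hpK)

set_option maxHeartbeats 400000 in
/-- **CELL QK, CLASS `LM`, BOTH PAIRS LIGHT ⟹ `Q` IS DEC.**  See the file header. [this work] -/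
theorem mixLawQ_decAtT_qk_twinHigh_lightBoth (y z g S lam : ℝ) (a j M k₁ k₂ : ℕ)
    (hy0 : 0 < y) (hy1 : y < 1) (hz0 : 0 ≤ z) (hz1 : z < 1) (hg1 : g ≤ 1) (hyg : y ≤ (1 - z) * g) (ha : 1 ≤ a)
    (hta : y * (M : ℝ) ≤ S) (hk : k₁ ≤ k₂) (hk₂M : k₂ ≤ M) (hlam0 : 0 ≤ lam) (hlam1 : lam ≤ 1)
    (hmean : (1 - z) * ((k₁ : ℝ) + ((k₂ : ℝ) - k₁) * lam) = S)
    (hk₁ : 1 ≤ k₁) (hk₁j : k₁ ≤ j) (hk₁low : 2 * (k₁ : ℝ) < S + (a : ℝ) * g * (1 - z))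
    (hPj : k₁ + a ≤ j) (hPmid : S + (a : ℝ) * g * (1 - z) ≤ 2 * ((k₁ + a : ℕ) : ℝ)) (hPt : S + (a : ℝ) * g * (1 - z) < (k₁ : ℝ) + a)
    (hKj : k₂ ≤ j) (hKlow : 2 * (k₂ : ℝ) < S + (a : ℝ) * g * (1 - z)) (hG : j + 1 ≤ k₂ + a)
    (hfit : usage y (S + (a : ℝ) * g * (1 - z)) j k₂ (k₁ + a) * ((1 - z) * lam * (1 - g)) ≤ (1 - z) * (1 - lam) * g)
    (hlightK : S + (a : ℝ) * g * (1 - z) - 2 * (k₂ : ℝ) < y * (((k₁ : ℝ) + a) - k₂))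
    (hlightk : S + (a : ℝ) * g * (1 - z) - 2 * (k₁ : ℝ) < y * (a : ℝ)) :
    DECAtT y (S + (a : ℝ) * g * (1 - z)) j (M + a)
      (fun p => z * (if p = 0 then (1 : ℝ) else 0) + (1 - z) * slice (fun q => TP[k₁, k₂, lam, q]) a g p) := by
  set t : ℝ := S + (a : ℝ) * g * (1 - z) with ht
  have hg0 : 0 < g := by
    by_contra hc
    have : (1 - z) * g ≤ 0 := mul_nonpos_of_nonneg_of_nonpos (by linarith) (not_lt.1 hc)
    linarith
  have h1z : 0 < 1 - z := by linarith
  have h1y : 0 < 1 - y := by linarith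
  have hC0 : 0 ≤ (1 - z) * lam * (1 - g) := mul_nonneg (mul_nonneg h1z.le hlam0) (by linarith)
  have hkr : (k₁ : ℝ) ≤ k₂ := by exact_mod_cast hk
  have hPr : ((k₁ + a : ℕ) : ℝ) = (k₁ : ℝ) + a := by push_cast; ring
  have hPng : ¬ (j + 1 ≤ k₁ + a) := by omega
  have hPcomp : t < (k₁ : ℝ) + ((k₁ + a : ℕ) : ℝ) := by have : (0:ℝ) ≤ k₁ := Nat.cast_nonneg k₁; rw [hPr]; linarith
  -- a light pair has usage `γ/(1−γ) ≤ y/(1−y)` (`γ = y² + (1−y)ρ ≤ y` when `ρ < y`)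
  have hlight : ∀ (l : ℕ) (ρ : ℝ), 0 < ρ → ρ < y →
      pairGate y t l (k₁ + a) = max ρ (y ^ 2 + (1 - y) * ρ) → usage y t j l (k₁ + a) ≤ y / (1 - y) := by
    intro l ρ hρ0 hρy hpg
    have hmax : ρ ≤ y ^ 2 + (1 - y) * ρ := by
      have h1 := mul_le_mul_of_nonneg_left hρy.le hy0.le
      nlinarith [sq y]
    have hγy : y ^ 2 + (1 - y) * ρ ≤ y := by
      have h1 := mul_le_mul_of_nonneg_left hρy.le h1y.le
      nlinarith [sq y]
    simp only [usage, gateOf, if_neg hPng]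
    rw [hpg, max_eq_right hmax, div_le_div_iff₀ (by nlinarith) h1y]
    nlinarith
  have hU₂ : usage y t j k₂ (k₁ + a) ≤ y / (1 - y) := by
    have hd : (0 : ℝ) < ((k₁ + a : ℕ) : ℝ) - k₂ := by rw [hPr]; linarith
    refine hlight k₂ ((t - 2 * (k₂ : ℝ)) / (((k₁ + a : ℕ) : ℝ) - k₂)) (div_pos (by linarith) hd)
      (by rw [div_lt_iff₀ hd, hPr]; linarith [hlightK]) ?_
    simp only [pairGate]
  have hU₁ : usage y t j k₁ (k₁ + a) ≤ y / (1 - y) := by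
    have ha1 : (1 : ℝ) ≤ a := by exact_mod_cast ha
    have hd : (0 : ℝ) < ((k₁ + a : ℕ) : ℝ) - k₁ := by rw [hPr]; linarith
    refine hlight k₁ ((t - 2 * (k₁ : ℝ)) / (((k₁ + a : ℕ) : ℝ) - k₁)) (div_pos (by linarith) hd)
      (by rw [div_lt_iff₀ hd, hPr]; linarith [hlightk]) ?_
    simp only [pairGate]
  have hU₁0 : 0 ≤ usage y t j k₁ (k₁ + a) := by
    have hγ0 : 0 < pairGate y t k₁ (k₁ + a) := pairGate_pos y t k₁ (k₁ + a) hk₁low (by omega)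
    have hγ1 : pairGate y t k₁ (k₁ + a) < 1 := pairGate_lt_one y t k₁ (k₁ + a) hy0 hy1 hk₁low hPcomp
    simp only [usage, gateOf, if_neg hPng]
    exact div_nonneg hγ0.le (by linarith)
  refine mixLawQ_decAtT_qk_twinHigh_of_Ib y z g S lam a j M k₁ k₂ hy0 hy1 hz0 hz1 hg1 hyg ha hta hk hk₂M hlam0 hlam1 hmean hk₁ hk₁j
    hk₁low hPj hPmid hPt hKj hKlow hG hfit ?_
  have hfit' : 0 ≤ (1 - z) * (1 - lam) * g - usage y t j k₂ (k₁ + a) * ((1 - z) * lam * (1 - g)) := by linarith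
  by_cases hXle : y * (z + (1 - z) * (1 - lam) * (1 - g)) - (1 - y) * ((1 - z) * lam * g) ≤ 0
  · have h1 := mul_nonpos_of_nonneg_of_nonpos hU₁0 hXle
    nlinarith [mul_nonneg hy0.le hfit']
  · have hX : y * (z + (1 - z) * (1 - lam) * (1 - g)) - (1 - y) * ((1 - z) * lam * g)
        = y * (1 - (1 - z) * (1 - lam) * g - (1 - z) * lam * (1 - g)) - (1 - z) * lam * g := by ring
    rw [hX] at hXle ⊢
    exact qk_Ib_ll y ((1 - z) * (1 - lam) * g) ((1 - z) * lam * (1 - g)) ((1 - z) * lam * g) _ _ hy0 hy1 hC0 hU₁ hU₂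
      (not_le.1 hXle).le (by nlinarith)

end LawDec

end Quant

end Summit.CriticalPhenomena.PercolationContinuityZ3.Theorems
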